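import Literature.NumberTheory.GelbartRogawski1991.LocalDoubledUnitaryDatum
import Literature.NumberTheory.Weil1964.DoublingDiagonalPolarisation
import Literature.LinearAlgebra.QuadraticForm.LagrangianTransitive
import HarnessLib

-- buildfix G11b-3 recipe (LEDGER B13-1/B13-3): elaborate sequentially so the trailing `attribute [implicit_reducible]`
-- block (reducibilityCoreExt is keyed to the async environment branch) is in force at `.olean` export.
set_option Elab.async false

/-!
# The rational symplectic element `δ` carries `ℓ_Δ = Res Δ` onto `ℓ_Y = 0 ⊕ Y` at every finite place
([Li1992, p. 181]; [Kudla1994, §3]: the doubling isomorphism `W ⊕ W⁻ ⊃ Δ ↦ Y`)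

Topic `NumberTheory/GelbartRogawski1991`; namespace
`Literature.NumberTheory.GelbartRogawski1991.UnitaryDualPair.LocalSplitting` (sequel of `LocalDoubledUnitaryDatum`).
KERNEL only: one proved theorem; no definition, no named fact, no `sorry`.

In the local symplectic space `𝕎_v = F_v^{n+n} × F_v^{n+n}` of the doubled hermitian space (Gram matrix
`gramD F n T₀ = e₂ (T₀ ⊕ −T₀) e₂`, `e₂ : Fin n ⊕ Fin n ≃ Fin (n+n)`), the tree's matrix `δ = deltaDiagMatrix`
([Weil1964]-side file `DoublingDiagonalPolarisation`, indexed by `(ι ⊕ ι) ⊕ (ι ⊕ ι)`), re-indexed by `e₂ ⊕ e₂` and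
transported to `Sp(𝕎_v)` by `SymplecticMatrix.transportSp` (Darboux coordinates `(x, y) ↦ (x, T y)`), maps the
Lagrangian `ℓ_Δ = deltaLagrangian F v n` (both halves agree) ONTO `ℓ_Y = lagrangianY F (n+n) v = 0 ⊕ F_v^{n+n}`
(`map_transportSp_deltaDiag_deltaLagrangian`).  Proof: on a diagonal point `((a, a), (y, y))` the Darboux `Y`-coordinate
is `(T₀ y, −T₀ y)` and `δ ((a, a); (c, −c)) = (0; (c, −a))` (tree `deltaDiagMatrix_mulVec_diag`), so the image lies in
`ℓ_Y`; equality by dimension (`ℓ_Δ` and `ℓ_Y` are Lagrangians, conjugate under `Sp`, tree `exists_isometries_map_eq`).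
This is the hypothesis `hδ'` of GR-1's parabolic normalisation `parabolicNorm_apply_zero` (`LocalDoubledUnitaryParabolicNorm`)
for GR-2's `deltaLoc v = transportSp (gramD ⊗ F_v) (mapHom (algebraMap L⁺ L⁺_v) δ^𝔻)` (any symplectic matrix with the
stated entries).

Written for the kernel construction of [GelbartRogawski1991, Prop. 3.1.1] behind the cited input `hGRU` of the
Hodge-CM period-theorem package (stage-1 cell `pub-hodgecm`, seat GR-1). Nothing here is a claim of the manuscripts
adjudicated by that cell.

## References

* J.-S. Li, *Non-vanishing theorems for the cohomology of certain arithmetic quotients*, J. reine angew. Math. 428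
  (1992), p. 181 (the element `δ`) [Li1992].
* S. S. Kudla, *Splitting metaplectic covers of dual reductive pairs*, Israel J. Math. 87 (1994), §3 [Kudla1994].
-/

set_option autoImplicit false

noncomputable section

open NumberField IsDedekindDomain Matrix
open Literature.RepresentationTheory.HeisenbergGroup Literature.RepresentationTheory.HeisenbergGroup.SymplecticMatrix
open Literature.NumberTheory.Automorphic Literature.NumberTheory.Automorphic.UnitaryGroup
open Literature.NumberTheory.Weil1964 Literature.LinearAlgebra.QuadraticForm

namespace Literature.NumberTheory.GelbartRogawski1991.UnitaryDualPair.LocalSplitting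

variable (F : Type) [Field F] [NumberField F] (v : HeightOneSpectrum (𝓞 F)) (n : ℕ) {T₀ : Matrix (Fin n) (Fin n) F}
  (hT₀d : IsUnit T₀.det)

include hT₀d in
/-- **`δ ℓ_Δ = ℓ_Y`**: the re-indexed `δ = deltaDiagMatrix`, transported to `Sp(𝕎_v)` along the Darboux coordinates of
the doubled Gram matrix `gramD F n T₀ ⊗ F_v`, carries `ℓ_Δ = Res Δ` onto `ℓ_Y = 0 ⊕ F_v^{n+n}`.
[cite: Li1992, p. 181; Kudla1994, §3] -/
theorem map_transportSp_deltaDiag_deltaLagrangian (hTv : IsUnit (localGram F (n + n) (gramD F n T₀) v).det)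
    (A : Matrix.symplecticGroup (Fin (n + n)) (v.adicCompletion F))
    (hA : (A : Matrix (Fin (n + n) ⊕ Fin (n + n)) (Fin (n + n) ⊕ Fin (n + n)) (v.adicCompletion F)) =
      Matrix.reindex ((e₂ n).sumCongr (e₂ n)) ((e₂ n).sumCongr (e₂ n)) (deltaDiagMatrix (v.adicCompletion F) (Fin n))) :
    (deltaLagrangian F v n).map (toLin F v (transportSp (localGram F (n + n) (gramD F n T₀) v) hTv A)) =
      lagrangianY F (n + n) v := by
  -- the doubled Gram matrix over `F_v` in `⊕`-indexing
  have hT : localGram F (n + n) (gramD F n T₀) v =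
      Matrix.reindex (e₂ n) (e₂ n) (Matrix.fromBlocks (T₀.map (algebraMap F (v.adicCompletion F))) 0 0 (-(T₀.map (algebraMap F (v.adicCompletion F))))) := by
    change (Matrix.reindex (e₂ n) (e₂ n) (Matrix.fromBlocks T₀ 0 0 (-T₀))).map (algebraMap F (v.adicCompletion F)) = _
    rw [Matrix.reindex_apply, Matrix.reindex_apply, ← Matrix.submatrix_map, Matrix.fromBlocks_map,
      Matrix.map_zero _ (map_zero _), Matrix.map_neg _ (map_neg _)]
  -- (≤): the `X`-coordinate of `δ p` vanishes for `p ∈ ℓ_Δ`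
  have hle : (deltaLagrangian F v n).map (toLin F v (transportSp (localGram F (n + n) (gramD F n T₀) v) hTv A)) ≤
      lagrangianY F (n + n) v := by
    rintro _ ⟨p, hp, rfl⟩
    rw [lagrangianY, Submodule.mem_prod]
    refine ⟨?_, Submodule.mem_top⟩
    rw [Submodule.mem_bot]
    change (((transportSp (localGram F (n + n) (gramD F n T₀) v) hTv A :
        symplecticGroup (polar (localPairing F (n + n) (gramD F n T₀) v))) :
          ((Fin (n + n) → (v.adicCompletion F)) × (Fin (n + n) → (v.adicCompletion F))) ≃ₗ[(v.adicCompletion F)] ((Fin (n + n) → (v.adicCompletion F)) × (Fin (n + n) → (v.adicCompletion F)))) p).1 = 0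
    rw [coe_transportSp_apply, SymplecticMatrix.darboux_symm_apply]
    dsimp only
    -- the halves of `p`
    obtain ⟨x, hx⟩ : ∃ x : Fin n → (v.adicCompletion F), p.1 ∘ (e₂ n) = Sum.elim x x :=
      ⟨fun i => p.1 (e₂ n (Sum.inl i)), funext fun s => by
        rcases s with i | i
        · rfl
        · exact ((hp i).1).symm⟩
    obtain ⟨y, hy⟩ : ∃ y : Fin n → (v.adicCompletion F), p.2 ∘ (e₂ n) = Sum.elim y y :=
      ⟨fun i => p.2 (e₂ n (Sum.inl i)), funext fun s => by
        rcases s with i | i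
        · rfl
        · exact ((hp i).2).symm⟩
    -- the Darboux `Y`-coordinate `T p.2 = e₂ (T₀ y, -T₀ y)`
    have hTy : (localGram F (n + n) (gramD F n T₀) v *ᵥ p.2) ∘ (e₂ n) =
        Sum.elim (T₀.map (algebraMap F (v.adicCompletion F)) *ᵥ y) (-(T₀.map (algebraMap F (v.adicCompletion F)) *ᵥ y)) := by
      rw [hT, Matrix.reindex_apply, Matrix.submatrix_mulVec_equiv, Function.comp_assoc, Equiv.symm_comp_self,
        Function.comp_id, Equiv.symm_symm, hy, Matrix.fromBlocks_mulVec, Matrix.zero_mulVec, Matrix.zero_mulVec, Matrix.neg_mulVec,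
        add_zero, zero_add, Sum.elim_comp_inl, Sum.elim_comp_inr]
    -- `A (darboux p) = (e₂ ⊕ e₂) (δ ((x, x); (T₀ y, -T₀ y))) = (e₂ ⊕ e₂) (0; (T₀ y, -x))`
    rw [hA, Matrix.reindex_apply, Matrix.submatrix_mulVec_equiv]
    have hu : (Sum.elim p.1 (localGram F (n + n) (gramD F n T₀) v *ᵥ p.2)) ∘ ((e₂ n).sumCongr (e₂ n)) =
        Sum.elim (Sum.elim x x) (Sum.elim (T₀.map (algebraMap F (v.adicCompletion F)) *ᵥ y) (-(T₀.map (algebraMap F (v.adicCompletion F)) *ᵥ y))) := by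
      rw [← hx, ← hTy]
      funext s
      rcases s with s | s <;> rfl
    funext k
    rw [Function.comp_apply, Function.comp_apply]
    change (deltaDiagMatrix (v.adicCompletion F) (Fin n) *ᵥ
        ((Sum.elim p.1 (localGram F (n + n) (gramD F n T₀) v *ᵥ p.2)) ∘ ((e₂ n).sumCongr (e₂ n))))
        (((e₂ n).sumCongr (e₂ n)).symm (Sum.inl k)) = 0
    rw [hu, deltaDiagMatrix_mulVec_diag, Equiv.sumCongr_symm, Equiv.sumCongr_apply, Sum.map_inl, Sum.elim_inl,
      Pi.zero_apply]
  -- equality by dimension: `ℓ_Δ` and `ℓ_Y` are conjugate Lagrangians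
  refine Submodule.eq_of_le_of_finrank_eq hle ?_
  rw [LinearEquiv.finrank_map_eq]
  obtain ⟨g, hg⟩ := exists_isometries_map_eq (isAlt_alt_polar F (n + n) (gramD F n T₀) v)
    (nondegenerate_alt_polar F (n + n) (gramD F n T₀) v (isUnit_det_gramD F n hT₀d))
    (deltaLagrangian_orthogonal F v n T₀ hT₀d) (orthogonal_lagrangianY F (n + n) (gramD F n T₀) v (isUnit_det_gramD F n hT₀d))
  rw [← hg, LinearEquiv.finrank_map_eq]

/-! ### Build-lane note (ops-buildfix G11b-3 recipe, LEDGER B13-1, 2026-08-21)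
`lean -o` (the hub build lane, never `lean`/the gate check) runs Lean 4.32's library-suggestion indexers
(`Lean.LibrarySuggestions.SymbolFrequency` / `SineQuaNon`, from their `exportEntriesFn`) over the statement of
every local theorem that is not a denied premise; on this family's statements (very large dependent binder
telescopes through the theta-kernel / dual-pair data) that fold runs for tens of minutes to hours and the build
lane kills the job (incident G11b-3, run/shared/lean/ops/buildfix/G11b-3-DOSSIER.md). `isDeniedPremise` skips
`[implicit_reducible]` constants before any fold, and a reducibility status on a *theorem* is inert (Meta never
unfolds `thmInfo`; the kernel ignores the attribute), so the public theorems of this file are tagged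
`[implicit_reducible]` purely to keep them out of that index. Only other effect: they are not offered by
`+suggestions` premise selectors. No statement or proof is changed; superseded if the operator lands a
deny-list form (`HarnessLib.PremiseIndex`). -/
set_option allowUnsafeReducibility true in
attribute [implicit_reducible]
  map_transportSp_deltaDiag_deltaLagrangian

end Literature.NumberTheory.GelbartRogawski1991.UnitaryDualPair.LocalSplitting

end
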